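import Mathlib.MeasureTheory.Integral.Bochner.Basic
import Mathlib.LinearAlgebra.Finsupp.LinearCombination
import Mathlib.Data.Finsupp.Order
import Mathlib.Topology.Order.OrderClosed
import Literature.Probability.LatticeModels.ScalingLimit
import Literature.Probability.LatticeModels.PolchinskiFlow
import HarnessLib

/-!
# The GKS moment (cone) order on laws of random fields

Topic `Literature/Probability/LatticeModels`; definition request `defn-MomentConeOrder` (route
CriticalPhenomena/Ising3DConformalLimit `MonotoneRG`, crux `StrongOrderPolchinski` =
stmt-CriticalPhenomena-6919: the renormalisation semiflow on laws of fields is to be a MONOTONE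
dynamical system for this order).

## Content

* `MomentConeOrder C ν ν'` (laws `ν, ν'` on a measurable space `E`, generating set `C` of real
  observables): **`ν ⪯ ν'` iff `E_ν[∏ᵢ Φᵢ] ≤ E_ν'[∏ᵢ Φᵢ]` for every finite family
  `Φ₁, …, Φₙ ∈ C`** (`mixedMoment`) — the integral stochastic order (A. Müller 1997) generated by
  the finite products of elements of `C`. It is a preorder (`MomentConeOrder.refl/trans`; the
  `Preorder` synonym `MomentOrderedLaw C`; `momentConeOrder_iff_momentFamily_le`: the pull-back
  of the `Pi` order under the moment map), antitone in `C` (`.anti`), CLOSED under limits along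
  which the relevant moments converge (`.of_tendsto`), preserved by push-forward along maps
  pulling `C'` back into `C` (`.map`). One observable: the order of the power moments
  (`momentConeOrder_singleton_iff`); on `Measure ℝ`, `ψ = id`: `∫ xⁿ dν ≤ ∫ xⁿ dν'` for all `n`
  (`momentConeOrder_id_iff`), the order in which the hierarchical Ising trajectory is monotone
  (`Literature.Barriers.CriticalPhenomena.HierarchicalRG.moment_traj_mono`).
* Random fields presented by a pairing `Φ : F → E → ℝ` (lattice fields, or test-function-indexed
  continuum fields): `fieldCone Φ = {Φ f | 0 ≤ f}`; `momentConeOrder_fieldCone_iff` is the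
  requested form **`ν ⪯ ν'` iff `E_ν ∏ᵢ Φ(fᵢ) ≤ E_ν' ∏ᵢ Φ(fᵢ)` for all finite families of
  non-negative test functions**.
* Real-valued fields `(Φ_x)_{x ∈ X}` (laws on `X → ℝ`, product σ-algebra): `smear f φ = ∑ₓ f x φ x`
  (`f : X →₀ ℝ`), **`LatticeMomentOrder`** `= MomentConeOrder (fieldCone smear)` — the
  Griffiths–Kelly–Sherman order: GKS II (Friedli–Velenik Thm 3.20, Ex. 3.9: `⟨σ_A⟩_J` is
  non-decreasing in `J ≥ 0`; in tree `gksExpect_mono_of_abs_le`) reads `J ≤ J' ⇒ μ_J ⪯ μ_J'`.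
  Link with correlation families: `corrFamilyOf ν n x = E_ν ∏ᵢ φ(xᵢ)` (a `LatticeCorrFamily d`
  when `X = Site d`); the order generated by the coordinates IS the `Pi` order
  `corrFamilyOf ν ≤ corrFamilyOf ν'` (`momentConeOrder_evalCone_iff`);
  `LatticeMomentOrder.corrFamilyOf_le`, and conversely under finite mixed moments
  (`HasLatticeMoments`, `latticeMomentOrder_iff_corrFamilyOf_le`, by multilinearity/positivity).
* Positive linear maps preserve it: `kernelMap K` for a row-finite kernel `K ≥ 0`
  (`LatticeMomentOrder.map_kernelMap`: block averages, convolution with a non-negative finitely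
  supported kernel), scalars `c ≥ 0` (`.map_smul`), Kadanoff block spins (`.blockSpinLaw`).

Conventions: expectations are Bochner integrals (junk value `0` for a non-integrable product —
the intended domain is laws with finite mixed moments, the hypothesis of the converse link); the
empty family `n = 0` compares total masses (vacuous between probability laws); only a PREorder
(antisymmetry would be moment determinacy). Not here: weak convergence + uniform moment bounds ⇒
convergence of moments (input to `.of_tendsto`); the measure-level GKS II for Ising Gibbs laws;
order preservation by the Polchinski semiflow (the route's crux).

## References

* S. Friedli, Y. Velenik, *Statistical Mechanics of Lattice Systems*, CUP 2017, §3.6.1,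
  Thm 3.20 (GKS inequalities) and Exercise 3.9 (`⟨σ_A⟩` increasing in `J, h`).
* D. G. Kelly, S. Sherman, J. Math. Phys. 9 (1968) 466–484 (GKS II); J. Ginibre, Comm. Math.
  Phys. 16 (1970) 310–328 (general formulation).
* A. Müller, Adv. Appl. Probab. 29 (1997) 414–428 (integral stochastic orders `≤_F`).
-/

noncomputable section

namespace Literature.Probability.LatticeModels

open _root_.MeasureTheory Filter Finset
open scoped _root_.Topology BigOperators

/-! ## 1. The moment cone order generated by a set of observables -/

section General

variable {E : Type*} [MeasurableSpace E]

/-- The **mixed moment** `E_ν[∏ᵢ Φᵢ]` of a law `ν` on `E` against a finite family of real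
observables `Φᵢ : E → ℝ`, `i < n` (Bochner integral: value `0` if the product is not
`ν`-integrable; for `n = 0` it is the total mass `(ν univ).toReal`). [folklore] -/
def mixedMoment (ν : Measure E) {n : ℕ} (Φ : Fin n → E → ℝ) : ℝ :=
  ∫ e, ∏ i, Φ i e ∂ν

/-- Unfolding of `mixedMoment`. [folklore] -/
theorem mixedMoment_def (ν : Measure E) {n : ℕ} (Φ : Fin n → E → ℝ) :
    mixedMoment ν Φ = ∫ e, ∏ i, Φ i e ∂ν := rfl

/-- **The moment cone order generated by a set `C` of observables** ("GKS moment order"):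
`ν ⪯ ν'` iff `E_ν[Φ₁ ⋯ Φₙ] ≤ E_ν'[Φ₁ ⋯ Φₙ]` for every `n` and every finite family
`Φ₁, …, Φₙ` of elements of `C` — the integral stochastic order generated by the finite products
of elements of `C` (Müller 1997). For random fields take `C = fieldCone Φ`, the smeared fields
against non-negative test functions (`LatticeMomentOrder`). [folklore] -/
def MomentConeOrder (C : Set (E → ℝ)) (ν ν' : Measure E) : Prop :=
  ∀ (n : ℕ) (Φ : Fin n → E → ℝ), (∀ i, Φ i ∈ C) → mixedMoment ν Φ ≤ mixedMoment ν' Φ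

namespace MomentConeOrder

variable {C : Set (E → ℝ)}

/-- The moment cone order is reflexive. [folklore] -/
protected theorem refl (C : Set (E → ℝ)) (ν : Measure E) : MomentConeOrder C ν ν :=
  fun _ _ _ => le_rfl

/-- The moment cone order is reflexive. [folklore] -/
protected theorem rfl {ν : Measure E} : MomentConeOrder C ν ν := MomentConeOrder.refl C ν

/-- The moment cone order is transitive. [folklore] -/
protected theorem trans {ν₁ ν₂ ν₃ : Measure E} (h₁₂ : MomentConeOrder C ν₁ ν₂)
    (h₂₃ : MomentConeOrder C ν₂ ν₃) : MomentConeOrder C ν₁ ν₃ :=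
  fun n Φ hΦ => (h₁₂ n Φ hΦ).trans (h₂₃ n Φ hΦ)

/-- The order is antitone in the generating set: a larger cone gives a stronger (finer) order.
[folklore] -/
theorem anti {C₁ C₂ : Set (E → ℝ)} (hC : C₁ ⊆ C₂) {ν ν' : Measure E}
    (h : MomentConeOrder C₂ ν ν') : MomentConeOrder C₁ ν ν' :=
  fun n Φ hΦ => h n Φ fun i => hC (hΦ i)

/-- **The moment cone order is closed**: if `μ_k ⪯ μ'_k` eventually along a filter and all the
relevant mixed moments of `μ_k`, `μ'_k` converge to those of `ν`, `ν'` (e.g. weak convergence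
with uniform bounds on higher moments), then `ν ⪯ ν'`. [folklore] -/
theorem of_tendsto {ι : Type*} {l : Filter ι} [l.NeBot] {μ μ' : ι → Measure E}
    {ν ν' : Measure E} (h : ∀ᶠ k in l, MomentConeOrder C (μ k) (μ' k))
    (hν : ∀ (n : ℕ) (Φ : Fin n → E → ℝ), (∀ i, Φ i ∈ C) →
      Tendsto (fun k => mixedMoment (μ k) Φ) l (𝓝 (mixedMoment ν Φ)))
    (hν' : ∀ (n : ℕ) (Φ : Fin n → E → ℝ), (∀ i, Φ i ∈ C) →
      Tendsto (fun k => mixedMoment (μ' k) Φ) l (𝓝 (mixedMoment ν' Φ))) :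
    MomentConeOrder C ν ν' :=
  fun n Φ hΦ => le_of_tendsto_of_tendsto (hν n Φ hΦ) (hν' n Φ hΦ) (h.mono fun _ hk => hk n Φ hΦ)

/-- **Push-forward along a map pulling the cone back into the cone preserves the order**: if
`g : E → E'` is measurable and `Ψ ∘ g ∈ C` for every (measurable) `Ψ ∈ C'`, then `ν ⪯_C ν'`
implies `g_* ν ⪯_{C'} g_* ν'`. (Positive linear maps of a random field — block averages,
convolution with a non-negative kernel, scaling by `c ≥ 0` — are the case `C = C' =` smeared
fields against non-negative test functions: `LatticeMomentOrder.map_kernelMap`.) [folklore] -/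
theorem map {E' : Type*} [MeasurableSpace E'] {C' : Set (E' → ℝ)} {g : E → E'}
    (hg : Measurable g) (hC' : ∀ Ψ ∈ C', Measurable Ψ) (hpull : ∀ Ψ ∈ C', Ψ ∘ g ∈ C)
    {ν ν' : Measure E} (h : MomentConeOrder C ν ν') :
    MomentConeOrder C' (ν.map g) (ν'.map g) := by
  intro n Ψ hΨ
  have hmeas : Measurable fun e' => ∏ i, Ψ i e' :=
    Finset.measurable_prod _ fun i _ => hC' _ (hΨ i)
  simp only [mixedMoment]
  rw [integral_map hg.aemeasurable hmeas.aestronglyMeasurable,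
    integral_map hg.aemeasurable hmeas.aestronglyMeasurable]
  exact h n (fun i => Ψ i ∘ g) fun i => hpull _ (hΨ i)

end MomentConeOrder

/-- The **moment map** of a law: all its mixed moments over `C`, as one real-valued function of
the finite family (its length `n` and its members `Φᵢ ∈ C`). [folklore] -/
def momentFamily (C : Set (E → ℝ)) (ν : Measure E) : (Σ n : ℕ, (Fin n → C)) → ℝ :=
  fun p => mixedMoment ν fun i => (p.2 i : E → ℝ)

/-- **The moment cone order is the pull-back of the pointwise (`Pi`) order under the moment
map** — on moment/correlation families it is the order Mathlib already has. [folklore] -/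
theorem momentConeOrder_iff_momentFamily_le {C : Set (E → ℝ)} {ν ν' : Measure E} :
    MomentConeOrder C ν ν' ↔ momentFamily C ν ≤ momentFamily C ν' := by
  constructor
  · rintro h ⟨n, Φ⟩
    exact h n (fun i => (Φ i : E → ℝ)) fun i => (Φ i).2
  · intro h n Φ hΦ
    exact h ⟨n, fun i => ⟨Φ i, hΦ i⟩⟩

/-- One generating observable `ψ`: `ν ⪯_{{ψ}} ν'` iff `E_ν[ψⁿ] ≤ E_ν'[ψⁿ]` for all `n`.
[folklore] -/
theorem momentConeOrder_singleton_iff (ψ : E → ℝ) {ν ν' : Measure E} :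
    MomentConeOrder {ψ} ν ν' ↔ ∀ n : ℕ, ∫ e, ψ e ^ n ∂ν ≤ ∫ e, ψ e ^ n ∂ν' := by
  constructor
  · intro h n
    have := h n (fun _ => ψ) fun _ => Set.mem_singleton _
    simpa [mixedMoment, Fin.prod_const] using this
  · intro h n Φ hΦ
    have hΦ' : Φ = fun _ => ψ := funext fun i => Set.mem_singleton_iff.1 (hΦ i)
    subst hΦ'
    simpa [mixedMoment, Fin.prod_const] using h n

/-- **On laws on `ℝ` (one real spin / block variable) the moment cone order of `id` is the order
of all moments**: `ν ⪯ ν'` iff `∫ xⁿ dν ≤ ∫ xⁿ dν'` for every `n` — the order in which the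
hierarchical Ising trajectory is monotone in the Ising parameter
(`HierarchicalRG.moment_traj_mono`). [folklore] -/
theorem momentConeOrder_id_iff {ν ν' : Measure ℝ} :
    MomentConeOrder {id} ν ν' ↔ ∀ n : ℕ, ∫ x, x ^ n ∂ν ≤ ∫ x, x ^ n ∂ν' :=
  momentConeOrder_singleton_iff id

/-- **Laws on `E` ordered by the moment cone order of `C`**: a type synonym of `Measure E` whose
`≤` is `MomentConeOrder C` (a `Preorder`; `Measure E` itself carries Mathlib's setwise order).
Enter with `MomentOrderedLaw.of C ν`. [folklore] -/
def MomentOrderedLaw (_C : Set (E → ℝ)) : Type _ := Measure E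

namespace MomentOrderedLaw

variable {C : Set (E → ℝ)}

/-- A law viewed as an element of the ordered synonym `MomentOrderedLaw C`. [folklore] -/
def of (C : Set (E → ℝ)) (ν : Measure E) : MomentOrderedLaw C := ν

/-- The underlying measure of an element of `MomentOrderedLaw C`. [folklore] -/
def toMeasure (ν : MomentOrderedLaw C) : Measure E := ν

/-- `toMeasure ∘ of = id`. [folklore] -/
@[simp] theorem toMeasure_of (ν : Measure E) : (of C ν).toMeasure = ν := rfl

/-- `of ∘ toMeasure = id`. [folklore] -/
@[simp] theorem of_toMeasure (ν : MomentOrderedLaw C) : of C ν.toMeasure = ν := rfl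

/-- **The moment cone order is a preorder** (the `Preorder` structure on laws it defines).
[folklore] -/
instance instPreorder : Preorder (MomentOrderedLaw C) where
  le ν ν' := MomentConeOrder C ν.toMeasure ν'.toMeasure
  le_refl ν := MomentConeOrder.refl C ν.toMeasure
  le_trans _ _ _ h h' := h.trans h'

/-- `of C ν ≤ of C ν'` is `MomentConeOrder C ν ν'`. [folklore] -/
theorem of_le_of_iff {ν ν' : Measure E} : of C ν ≤ of C ν' ↔ MomentConeOrder C ν ν' := Iff.rfl

end MomentOrderedLaw

end General

/-! ## 2. Random fields presented by a pairing with test functions -/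

section Field

variable {E : Type*} {F : Type*} [Zero F] [LE F]

/-- The generating cone of a random field presented by a pairing `Φ : F → E → ℝ`
(`Φ f` = the field smeared against the test function `f`): the observables `Φ f` with `f ≥ 0`.
[folklore] -/
def fieldCone (Φ : F → E → ℝ) : Set (E → ℝ) := Φ '' {f | 0 ≤ f}

/-- `Φ f ∈ fieldCone Φ` for `f ≥ 0`. [folklore] -/
theorem mem_fieldCone {Φ : F → E → ℝ} {f : F} (hf : 0 ≤ f) : Φ f ∈ fieldCone Φ := ⟨f, hf, rfl⟩

variable [MeasurableSpace E]

/-- **The GKS moment order of random fields, as requested**: `ν ⪯ ν'` iff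
`E_ν ∏ᵢ Φ(fᵢ) ≤ E_ν' ∏ᵢ Φ(fᵢ)` for every `n` and every family `f₁, …, fₙ` of NON-NEGATIVE test
functions. [folklore] -/
theorem momentConeOrder_fieldCone_iff {Φ : F → E → ℝ} {ν ν' : Measure E} :
    MomentConeOrder (fieldCone Φ) ν ν' ↔ ∀ (n : ℕ) (f : Fin n → F), (∀ i, 0 ≤ f i) →
      ∫ e, ∏ i, Φ (f i) e ∂ν ≤ ∫ e, ∏ i, Φ (f i) e ∂ν' := by
  constructor
  · intro h n f hf
    exact h n (fun i => Φ (f i)) fun i => mem_fieldCone (hf i)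
  · intro h n Ψ hΨ
    have hΨ' : ∀ i, ∃ f, 0 ≤ f ∧ Φ f = Ψ i := fun i => (Set.mem_image _ _ _).1 (hΨ i)
    choose f hf hfΨ using hΨ'
    have : Ψ = fun i => Φ (f i) := funext fun i => (hfΨ i).symm
    subst this
    exact h n f hf

end Field

/-! ## 3. Real-valued random fields over an index set: the lattice GKS order -/

section Lattice

variable {X Y : Type*}

/-- The field `φ : X → ℝ` **smeared** against a finitely supported test function `f`:
`Φ(f)(φ) = ∑ₓ f x · φ x`. [folklore] -/
def smear (f : X →₀ ℝ) (φ : X → ℝ) : ℝ := Finsupp.linearCombination ℝ φ f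

/-- `smear f φ = ∑_{x ∈ supp f} f x · φ x`. [folklore] -/
theorem smear_eq_sum (f : X →₀ ℝ) (φ : X → ℝ) : smear f φ = ∑ x ∈ f.support, f x * φ x := by
  simp only [smear, Finsupp.linearCombination_apply, Finsupp.sum, smul_eq_mul]

/-- Smearing against `a · δ_x` evaluates the field: `Φ(a δ_x)(φ) = a · φ x`. [folklore] -/
@[simp] theorem smear_single (x : X) (a : ℝ) (φ : X → ℝ) :
    smear (Finsupp.single x a) φ = a * φ x := by
  simp [smear, Finsupp.linearCombination_single]

/-- `smear f` is linear in the test function: finite sums. [folklore] -/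
theorem smear_finset_sum {ι : Type*} (s : Finset ι) (f : ι → X →₀ ℝ) (φ : X → ℝ) :
    smear (∑ k ∈ s, f k) φ = ∑ k ∈ s, smear (f k) φ :=
  map_sum (Finsupp.linearCombination ℝ φ) f s

/-- `smear f` is measurable for the product σ-algebra on `X → ℝ` (a finite linear combination of
coordinates). [folklore] -/
theorem measurable_smear (f : X →₀ ℝ) : Measurable (smear f) := by
  have : smear f = fun φ => ∑ x ∈ f.support, f x * φ x := funext (smear_eq_sum f)
  rw [this]
  exact Finset.measurable_sum _ fun x _ => (measurable_pi_apply x).const_mul _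

/-- **The Griffiths–Kelly–Sherman moment order on laws of real-valued random fields
`(Φ_x)_{x ∈ X}`** (laws on `X → ℝ`): `ν ⪯ ν'` iff `E_ν ∏ᵢ Φ(fᵢ) ≤ E_ν' ∏ᵢ Φ(fᵢ)` for all finite
families of non-negative finitely supported test functions `fᵢ : X →₀ ℝ`
(`latticeMomentOrder_iff`). GKS II — every correlation `⟨σ_A⟩_J` of a ferromagnet is
non-decreasing in the couplings `J ≥ 0` — is the statement that `J ≤ J'` implies `μ_J ⪯ μ_J'`
for the Gibbs laws. [cite: FriedliVelenik2017, §3.6.1 Thm 3.20 and Exercise 3.9] -/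
abbrev LatticeMomentOrder (ν ν' : Measure (X → ℝ)) : Prop :=
  MomentConeOrder (fieldCone (smear (X := X))) ν ν'

/-- The requested form of the lattice GKS order: products of smeared fields against non-negative
test functions. [cite: FriedliVelenik2017, §3.6.1 Thm 3.20 and Exercise 3.9] -/
theorem latticeMomentOrder_iff {ν ν' : Measure (X → ℝ)} :
    LatticeMomentOrder ν ν' ↔ ∀ (n : ℕ) (f : Fin n → X →₀ ℝ), (∀ i, 0 ≤ f i) →
      ∫ φ, ∏ i, smear (f i) φ ∂ν ≤ ∫ φ, ∏ i, smear (f i) φ ∂ν' :=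
  momentConeOrder_fieldCone_iff

/-- **The correlation (moment) family of a law on fields**: `G_ν n x = E_ν[φ(x₁) ⋯ φ(xₙ)]`.
For `X = Site d` this is a `LatticeCorrFamily d` (`latticeCorrFamilyOf`). [folklore] -/
def corrFamilyOf (ν : Measure (X → ℝ)) : (n : ℕ) → (Fin n → X) → ℝ :=
  fun _ x => ∫ φ, ∏ i, φ (x i) ∂ν

/-- Unfolding of `corrFamilyOf`. [folklore] -/
theorem corrFamilyOf_apply (ν : Measure (X → ℝ)) (n : ℕ) (x : Fin n → X) :
    corrFamilyOf ν n x = ∫ φ, ∏ i, φ (x i) ∂ν := rfl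

/-- The correlation family of a law on fields over `ℤ^d`, as a `LatticeCorrFamily d`
(the input type of `rescaledCorrelator` / `HasPointwiseScalingLimit`). [folklore] -/
abbrev latticeCorrFamilyOf {d : ℕ} (ν : Measure (Site d → ℝ)) : LatticeCorrFamily d :=
  corrFamilyOf ν

/-- The coordinate observables `φ ↦ φ x`, `x ∈ X`. [folklore] -/
def evalCone (X : Type*) : Set ((X → ℝ) → ℝ) := Set.range fun (x : X) (φ : X → ℝ) => φ x

/-- **The order generated by the coordinate observables is the pointwise (`Pi`) order of the
correlation families** `corrFamilyOf ν ≤ corrFamilyOf ν'`, i.e.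
`E_ν ∏ᵢ φ(xᵢ) ≤ E_ν' ∏ᵢ φ(xᵢ)` for all `n` and `x : Fin n → X`. [folklore] -/
theorem momentConeOrder_evalCone_iff {ν ν' : Measure (X → ℝ)} :
    MomentConeOrder (evalCone X) ν ν' ↔ corrFamilyOf ν ≤ corrFamilyOf ν' := by
  constructor
  · intro h n x
    exact h n (fun i φ => φ (x i)) fun i => Set.mem_range.2 ⟨x i, rfl⟩
  · intro h n Φ hΦ
    have hΦ' : ∀ i, ∃ x : X, (fun φ : X → ℝ => φ x) = Φ i := fun i => Set.mem_range.1 (hΦ i)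
    choose x hx using hΦ'
    have : Φ = fun i φ => φ (x i) := funext fun i => (hx i).symm
    subst this
    exact h n x

/-- Coordinate observables are smeared fields against `δ_x ≥ 0`. [folklore] -/
theorem evalCone_subset_fieldCone : evalCone X ⊆ fieldCone (smear (X := X)) := by
  rintro _ ⟨x, rfl⟩
  refine ⟨Finsupp.single x 1, ?_, ?_⟩
  · show (0 : X →₀ ℝ) ≤ Finsupp.single x 1
    exact Finsupp.single_nonneg.2 zero_le_one
  · funext φ
    simp

/-- **Lattice GKS order ⇒ pointwise order of correlation families.** [folklore] -/
theorem LatticeMomentOrder.corrFamilyOf_le {ν ν' : Measure (X → ℝ)} (h : LatticeMomentOrder ν ν') :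
    corrFamilyOf ν ≤ corrFamilyOf ν' :=
  momentConeOrder_evalCone_iff.1 (h.anti evalCone_subset_fieldCone)

/-- **Finite mixed moments**: every monomial `φ(x₁) ⋯ φ(xₙ)` is `ν`-integrable ("all moments
assumed finite"). [folklore] -/
def HasLatticeMoments (ν : Measure (X → ℝ)) : Prop :=
  ∀ (n : ℕ) (x : Fin n → X), Integrable (fun φ : X → ℝ => ∏ i, φ (x i)) ν

/-- Multilinear expansion of a product of smeared fields into monomials:
`∏ᵢ Φ(fᵢ)(φ) = ∑_g (∏ᵢ fᵢ(g i)) · ∏ᵢ φ(g i)`, `g` ranging over `∏ᵢ supp fᵢ`. [folklore] -/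
theorem prod_smear_eq_sum {n : ℕ} (f : Fin n → X →₀ ℝ) (φ : X → ℝ) :
    ∏ i, smear (f i) φ =
      ∑ g ∈ Fintype.piFinset fun i => (f i).support, (∏ i, f i (g i)) * ∏ i, φ (g i) := by
  simp_rw [smear_eq_sum]
  rw [Finset.prod_univ_sum]
  refine Finset.sum_congr rfl fun g _ => ?_
  rw [Finset.prod_mul_distrib]

/-- Moments of smeared fields as weighted sums of the correlation family (finite moments):
`E_ν ∏ᵢ Φ(fᵢ) = ∑_g (∏ᵢ fᵢ(g i)) · G_ν n g`. [folklore] -/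
theorem integral_prod_smear {ν : Measure (X → ℝ)} (hν : HasLatticeMoments ν) {n : ℕ}
    (f : Fin n → X →₀ ℝ) :
    ∫ φ, ∏ i, smear (f i) φ ∂ν =
      ∑ g ∈ Fintype.piFinset fun i => (f i).support, (∏ i, f i (g i)) * corrFamilyOf ν n g := by
  simp_rw [prod_smear_eq_sum]
  rw [integral_finsetSum _ fun g _ => (hν n g).const_mul _]
  simp_rw [integral_const_mul]
  rfl

/-- **Pointwise order of correlation families ⇒ lattice GKS order**, when all mixed moments are
finite (multilinearity and positivity of the test functions). [folklore] -/
theorem latticeMomentOrder_of_corrFamilyOf_le {ν ν' : Measure (X → ℝ)} (hν : HasLatticeMoments ν)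
    (hν' : HasLatticeMoments ν') (h : corrFamilyOf ν ≤ corrFamilyOf ν') :
    LatticeMomentOrder ν ν' := by
  rw [latticeMomentOrder_iff]
  intro n f hf
  rw [integral_prod_smear hν, integral_prod_smear hν']
  refine Finset.sum_le_sum fun g _ => mul_le_mul_of_nonneg_left (h n g) ?_
  exact Finset.prod_nonneg fun i _ => by simpa using (Finsupp.le_def.1 (hf i)) (g i)

/-- **The measure-level GKS order and the `Pi` order on correlation families agree** on laws
with finite mixed moments. [folklore] -/
theorem latticeMomentOrder_iff_corrFamilyOf_le {ν ν' : Measure (X → ℝ)}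
    (hν : HasLatticeMoments ν) (hν' : HasLatticeMoments ν') :
    LatticeMomentOrder ν ν' ↔ corrFamilyOf ν ≤ corrFamilyOf ν' :=
  ⟨LatticeMomentOrder.corrFamilyOf_le, latticeMomentOrder_of_corrFamilyOf_le hν hν'⟩

/-! ### Positive linear maps of the field preserve the order -/

/-- A **positive row-finite kernel map of fields**: `(K φ)(y) = ∑ₓ K y x · φ x`, i.e.
`(K φ)(y) = Φ(K y)(φ)` for a family of finitely supported test functions `K y` (block averages,
convolution with a finitely supported kernel, scalings). [folklore] -/
def kernelMap (K : Y → X →₀ ℝ) (φ : X → ℝ) : Y → ℝ := fun y => smear (K y) φ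

/-- Unfolding of `kernelMap`. [folklore] -/
theorem kernelMap_apply (K : Y → X →₀ ℝ) (φ : X → ℝ) (y : Y) :
    kernelMap K φ y = smear (K y) φ := rfl

/-- Kernel maps are measurable for the product σ-algebras. [folklore] -/
theorem measurable_kernelMap (K : Y → X →₀ ℝ) : Measurable (kernelMap K) :=
  measurable_pi_lambda _ fun y => measurable_smear (K y)

/-- **Pull-back of a smeared field under a kernel map is a smeared field**:
`Φ(g)(K φ) = Φ(Kᵀ g)(φ)` with `Kᵀ g = ∑_y g y · K y`. [folklore] -/
theorem smear_kernelMap (K : Y → X →₀ ℝ) (g : Y →₀ ℝ) (φ : X → ℝ) :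
    smear g (kernelMap K φ) = smear (Finsupp.linearCombination ℝ K g) φ := by
  simp only [smear]
  rw [Finsupp.apply_linearCombination]
  rfl

/-- `Kᵀ g ≥ 0` when `g ≥ 0` and all rows `K y ≥ 0`. [folklore] -/
theorem linearCombination_nonneg {K : Y → X →₀ ℝ} (hK : ∀ y, 0 ≤ K y) {g : Y →₀ ℝ}
    (hg : 0 ≤ g) : 0 ≤ Finsupp.linearCombination ℝ K g := by
  have hg' : ∀ y, 0 ≤ g y := fun y => by simpa using Finsupp.le_def.1 hg y
  have hK' : ∀ y x, 0 ≤ K y x := fun y x => by simpa using Finsupp.le_def.1 (hK y) x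
  refine Finsupp.le_def.2 fun x => ?_
  rw [Finsupp.linearCombination_apply, Finsupp.sum_apply]
  simp only [Finsupp.coe_zero, Pi.zero_apply, Finsupp.sum, Finsupp.coe_smul, Pi.smul_apply,
    smul_eq_mul]
  exact Finset.sum_nonneg fun y _ => mul_nonneg (hg' y) (hK' y x)

/-- **Positive kernel maps preserve the lattice GKS order**: if all rows `K y ≥ 0` then
`ν ⪯ ν'` implies `K_* ν ⪯ K_* ν'` (block averaging, convolution with a non-negative kernel,
multiplication by `c ≥ 0`). [folklore] -/
theorem LatticeMomentOrder.map_kernelMap {K : Y → X →₀ ℝ} (hK : ∀ y, 0 ≤ K y)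
    {ν ν' : Measure (X → ℝ)} (h : LatticeMomentOrder ν ν') :
    LatticeMomentOrder (ν.map (kernelMap K)) (ν'.map (kernelMap K)) := by
  refine MomentConeOrder.map (measurable_kernelMap K) ?_ ?_ h
  · rintro _ ⟨g, -, rfl⟩
    exact measurable_smear g
  · rintro _ ⟨g, hg, rfl⟩
    refine ⟨Finsupp.linearCombination ℝ K g, linearCombination_nonneg hK hg, ?_⟩
    funext φ
    exact (smear_kernelMap K g φ).symm

/-- Multiplication of the field by a scalar `c` is the kernel map with rows `c · δ_y`.
[folklore] -/
theorem kernelMap_single (c : ℝ) :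
    kernelMap (fun y : X => Finsupp.single y c) = fun φ => c • φ := by
  funext φ y
  simp [kernelMap, Pi.smul_apply, smul_eq_mul]

/-- **Multiplication of the field by `c ≥ 0` preserves the lattice GKS order.** [folklore] -/
theorem LatticeMomentOrder.map_smul {c : ℝ} (hc : 0 ≤ c) {ν ν' : Measure (X → ℝ)}
    (h : LatticeMomentOrder ν ν') :
    LatticeMomentOrder (ν.map fun φ => c • φ) (ν'.map fun φ => c • φ) := by
  rw [← kernelMap_single c]
  exact h.map_kernelMap fun y => Finsupp.single_nonneg.2 hc

/-- The Kadanoff block-spin map `(blockSpin b c φ)(x) = c ∑_{y ∈ [0,b)^d} φ(b x + y)` is the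
kernel map with rows `c ∑_y δ_{b x + y}`. [folklore] -/
theorem Kadanoff.blockSpin_eq_kernelMap {d : ℕ} (b : ℕ) (c : ℝ) :
    Kadanoff.blockSpin (d := d) b c = kernelMap fun x : Site d =>
      ∑ y ∈ Kadanoff.blockCells d b, Finsupp.single (fun i => (b : ℤ) * x i + (y i : ℤ)) c := by
  funext φ x
  simp only [Kadanoff.blockSpin, kernelMap, smear_finset_sum, smear_single, Finset.mul_sum]

/-- **Kadanoff block-spin maps with field renormalisation `c ≥ 0` preserve the lattice GKS
order** (`blockSpinLaw b c` is monotone). [folklore] -/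
theorem LatticeMomentOrder.blockSpinLaw {d : ℕ} (b : ℕ) {c : ℝ} (hc : 0 ≤ c)
    {ν ν' : Measure (Site d → ℝ)} (h : LatticeMomentOrder ν ν') :
    LatticeMomentOrder (Kadanoff.blockSpinLaw b c ν) (Kadanoff.blockSpinLaw b c ν') := by
  simp only [Kadanoff.blockSpinLaw, Kadanoff.blockSpin_eq_kernelMap]
  refine h.map_kernelMap fun x => Finsupp.le_def.2 fun z => ?_
  simp only [Finsupp.coe_zero, Pi.zero_apply, Finsupp.coe_finsetSum, Finset.sum_apply]
  exact Finset.sum_nonneg fun y _ => by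
    classical
    rw [Finsupp.single_apply]
    split_ifs
    · exact hc
    · exact le_rfl

end Lattice

end Literature.Probability.LatticeModels
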